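import Summits.CriticalPhenomena.PercolationContinuityZ3.Theorems.PercNearOneGluingNoHeavyLowerTailKnQuestion8CoefficientwiseCoreClassKernelMixHSpace

/-!
# Cycle factors for cycles of length one and two

Support file (`--supports stmt-CriticalPhenomena-4575`, closed), prover `prim-cplus-coupling` (gen 66).  No notations, no named facts, no sorries; standard axioms.
Memo `prim-cplus-coupling/A5-COUPLING-gen66.md` §1.1 (degenerate cycles).

A loop (`C₁`, one edge through the hub) has colourings `Bool`, no interior vertices, levels `∅` and `NF = {blue}`; a digon (`C₂`) has colourings `Bool × Bool`,
one interior vertex seen by the hub exactly when some edge is blue, levels `∅` and `NF = {not both red}`.  Both are `HSpace.IsCycleFactor`s with the evident matchings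
(`loopPhi`, `digonPhi`) and layer maps (`loopLam`, `digonLam`), completing the single-cycle inputs of the two-type theorem for ALL cycle lengths.
[cite: KozmaNitzan2024, Questions 8–9 (§5.5 p. 36) (context); Harris 1960; Kleitman 1966]
-/

namespace Summit.CriticalPhenomena.PercolationContinuityZ3.Theorems.Coefficientwise.SmallCycles

open Finset HSpace

/-- Levels of the loop: subfamilies of `{blue}`. -/
def LoopLevel (V : Finset Bool) : Prop := V ⊆ {false}
/-- Matching of the loop: everything to the red word. -/
def loopPhi (_ : Finset Bool) (_ : Bool) : Bool := true
/-- Layer map of the loop: the red word to the blue word. -/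
def loopLam (_ : Bool) : Bool := false

/-- **The loop is a cycle factor.** -/
theorem isCycleFactor_loop : IsCycleFactor (Y := Bool) {false} {true} (fun b => !b) LoopLevel loopPhi loopLam := by
  refine ⟨fun V hV => hV, ?_, ?_, ?_, ?_, ?_, ?_, ?_⟩
  · intro V hV y hy; have := mem_singleton.mp (hV hy); subst this; simp [loopPhi]
  · intro V hV y hy; have := mem_singleton.mp (hV hy); subst this; simpa [loopPhi] using hy
  · intro V hV y hy y' hy' _; rw [mem_singleton.mp (hV hy), mem_singleton.mp (hV hy')]
  · intro V _ y _; simp [loopPhi]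
  · intro a ha b hb _; rw [mem_coe, mem_singleton] at ha hb; rw [ha, hb]
  · intro y _; simp [loopLam]
  · intro V hV y hy; have := mem_singleton.mp (hV hy); subst this; simp [loopLam]

/-- Levels of the digon: empty or all non-full colourings. -/
def DigonLevel (V : Finset (Bool × Bool)) : Prop := V = ∅ ∨ V = univ.erase (true, true)
/-- Matching of the digon: `(B,B) ↦ (R,R)`, the one-red words fixed. -/
def digonPhi (_ : Finset (Bool × Bool)) (w : Bool × Bool) : Bool × Bool := if w = (false, false) then (true, true) else w
/-- Layer map of the digon: `(R,R) ↦ (B,B)`, identity elsewhere. -/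
def digonLam (w : Bool × Bool) : Bool × Bool := if w = (true, true) then (false, false) else w

/-- **The digon is a cycle factor.** -/
theorem isCycleFactor_digon :
    IsCycleFactor (Y := Bool × Bool) (univ.erase (true, true)) (univ.erase (false, false)) (fun w => (!w.1, !w.2)) DigonLevel digonPhi digonLam := by
  have hmem : ∀ {V : Finset (Bool × Bool)} {y : Bool × Bool}, DigonLevel V → y ∈ V → V = univ.erase (true, true) ∧ y ≠ (true, true) := by
    intro V y hV hy
    rcases hV with h | h
    · subst h; simp at hy
    · subst h; exact ⟨rfl, (mem_erase.mp hy).1⟩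
  refine ⟨?_, ?_, ?_, ?_, ?_, ?_, ?_, ?_⟩
  · intro V hV y hy; obtain ⟨rfl, _⟩ := hmem hV hy; exact hy
  · intro V hV y hy; obtain ⟨_, hne⟩ := hmem hV hy
    obtain ⟨a, b⟩ := y; revert hne; cases a <;> cases b <;> simp [digonPhi]
  · intro V hV y hy; obtain ⟨rfl, hne⟩ := hmem hV hy
    obtain ⟨a, b⟩ := y; revert hne; cases a <;> cases b <;> simp [digonPhi]
  · intro V hV y hy y' hy' e; obtain ⟨_, hne⟩ := hmem hV hy; obtain ⟨_, hne'⟩ := hmem hV hy'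
    obtain ⟨a, b⟩ := y; obtain ⟨a', b'⟩ := y'; revert hne hne' e; cases a <;> cases b <;> cases a' <;> cases b' <;> simp [digonPhi]
  · intro V hV y hy; obtain ⟨_, hne⟩ := hmem hV hy
    obtain ⟨a, b⟩ := y; revert hne; cases a <;> cases b <;> simp [digonPhi]
  · intro a ha b hb e
    have ha' := (mem_erase.mp (mem_coe.mp ha)).1; have hb' := (mem_erase.mp (mem_coe.mp hb)).1
    obtain ⟨a1, a2⟩ := a; obtain ⟨b1, b2⟩ := b; revert ha' hb' e
    cases a1 <;> cases a2 <;> cases b1 <;> cases b2 <;> simp [digonLam]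
  · intro y hy; have hy' := (mem_erase.mp hy).1
    obtain ⟨a, b⟩ := y; revert hy'; cases a <;> cases b <;> simp [digonLam]
  · intro V hV y hy; obtain ⟨_, hne⟩ := hmem hV hy
    obtain ⟨a, b⟩ := y; revert hne; cases a <;> cases b <;> simp [digonPhi, digonLam]

end Summit.CriticalPhenomena.PercolationContinuityZ3.Theorems.Coefficientwise.SmallCycles
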